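import Summits.QuantumAdvantage.QuantumAdvantage.Theorems.CharDialTwoBlockMoebius
import Mathlib.Data.Fintype.BigOperators
import HarnessLib

/-!
# MultiBlockMoebius — Möbius coefficients and the binomial basis for m-block-symmetric functions

(decomp-qadv-lens-6 g8, support file for `MultiBlockFrob.lean`; generalises `TwoBlockMoebius.lean` from two blocks
to a disjoint family `A : Fin m → Finset (Fin n)`.)
* `sum_powerset_mBlock` — `Σ_{T ⊆ S} G (|T ∩ A_j|)_j = Σ_{i ≤ w} (Π_j C(w_j, i_j)) • G i` for `S` inside the blocks;
* `moeb_mBlock` — Möbius coefficients of a function of the block weights depend only on the intersection sizes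
  (`gamM`, an m-fold binomial transform);
* `binomPm k i = C(X_k, i)` in `MvPolynomial (Fin m) (ZMod p)`, total degree `≤ i`, `eval = C(x_k.val, i)` (`i < p`).
-/

namespace Summit.QuantumAdvantage.AdviceFreeQNC0

namespace SubChar

open Finset
open Literature.Computability.MetaComplexity Literature.Computability.MetaComplexity.Smolensky
open SubLog

variable {n m : ℕ}

/-! ### Disjoint block families -/

/-- The union of a block family. -/
def blockUnion (A : Fin m → Finset (Fin n)) : Finset (Fin n) := Finset.univ.biUnion A

/-- CharDial sub-characteristic helper `biUnion_inter_block` (lens-6 g8 LAND package; see the module docstring). -/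
theorem biUnion_inter_block {A : Fin m → Finset (Fin n)} (hdis : ∀ j k, j ≠ k → Disjoint (A j) (A k))
    (x : Fin m → Finset (Fin n)) (hx : ∀ j, x j ⊆ A j) (j : Fin m) :
    (Finset.univ.biUnion x) ∩ A j = x j := by
  classical
  ext i
  simp only [mem_inter, mem_biUnion, mem_univ, true_and]
  constructor
  · rintro ⟨⟨k, hk⟩, hij⟩
    by_cases hkj : k = j
    · subst hkj; exact hk
    · exact absurd hij (disjoint_left.1 (hdis k j hkj) (hx k hk))
  · intro hi
    exact ⟨⟨j, hi⟩, hx j hi⟩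

/-- CharDial sub-characteristic helper `biUnion_subset_blockUnion` (lens-6 g8 LAND package; see the module docstring). -/
theorem biUnion_subset_blockUnion {A : Fin m → Finset (Fin n)} (x : Fin m → Finset (Fin n))
    (hx : ∀ j, x j ⊆ A j) : Finset.univ.biUnion x ⊆ blockUnion A := by
  classical
  intro i hi
  simp only [blockUnion, mem_biUnion, mem_univ, true_and] at hi ⊢
  obtain ⟨j, hj⟩ := hi
  exact ⟨j, hx j hj⟩

/-- CharDial sub-characteristic helper `eq_biUnion_inter` (lens-6 g8 LAND package; see the module docstring). -/
theorem eq_biUnion_inter {A : Fin m → Finset (Fin n)} {T : Finset (Fin n)} (hT : T ⊆ blockUnion A) :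
    T = Finset.univ.biUnion fun j => T ∩ A j := by
  classical
  ext i
  simp only [mem_biUnion, mem_univ, true_and, mem_inter]
  constructor
  · intro hi
    have := hT hi
    simp only [blockUnion, mem_biUnion, mem_univ, true_and] at this
    obtain ⟨j, hj⟩ := this
    exact ⟨j, hi, hj⟩
  · rintro ⟨j, hi, _⟩; exact hi

/-- For `T` inside the blocks, `|T| = Σ_j |T ∩ A_j|`. -/
theorem card_eq_mBlock {A : Fin m → Finset (Fin n)} (hdis : ∀ j k, j ≠ k → Disjoint (A j) (A k))
    {T : Finset (Fin n)} (hT : T ⊆ blockUnion A) : T.card = ∑ j, (T ∩ A j).card := by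
  classical
  conv_lhs => rw [eq_biUnion_inter hT]
  rw [card_biUnion]
  intro j _ k _ hjk
  exact disjoint_of_subset_left inter_subset_right (disjoint_of_subset_right inter_subset_right (hdis j k hjk))

/-- Realising a weight vector by a set inside the blocks. -/
theorem exists_realize {A : Fin m → Finset (Fin n)} (hdis : ∀ j k, j ≠ k → Disjoint (A j) (A k))
    (w : Fin m → ℕ) (hw : ∀ j, w j ≤ (A j).card) :
    ∃ T ⊆ blockUnion A, ∀ j, (T ∩ A j).card = w j := by
  classical
  have hX : ∀ j, ∃ X ⊆ A j, X.card = w j := fun j => Finset.exists_subset_card_eq (hw j)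
  choose X hXA hXc using hX
  refine ⟨Finset.univ.biUnion X, biUnion_subset_blockUnion X hXA, fun j => ?_⟩
  rw [biUnion_inter_block hdis X hXA j, hXc j]

/-! ### m-fold double counting over the powerset -/

/-- `Σ_{T ⊆ S} G (|T ∩ A_j|)_j = Σ_{i ≤ w(S)} (Π_j C(w_j, i_j)) • G i` for `S` inside the disjoint blocks. -/
theorem sum_powerset_mBlock {R : Type*} [AddCommMonoid R] {A : Fin m → Finset (Fin n)}
    (hdis : ∀ j k, j ≠ k → Disjoint (A j) (A k)) {S : Finset (Fin n)} (hS : S ⊆ blockUnion A)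
    (G : (Fin m → ℕ) → R) :
    ∑ T ∈ S.powerset, G (fun j => (T ∩ A j).card) =
      ∑ i ∈ Fintype.piFinset (fun j => range ((S ∩ A j).card + 1)),
        (∏ j, (S ∩ A j).card.choose (i j)) • G i := by
  classical
  -- step 1: T ↦ (T ∩ A_j)_j is a bijection onto Π_j 𝒫(S ∩ A_j)
  have step1 : ∑ T ∈ S.powerset, G (fun j => (T ∩ A j).card) =
      ∑ x ∈ Fintype.piFinset (fun j => (S ∩ A j).powerset), G (fun j => (x j).card) := by
    refine Finset.sum_nbij' (fun T => fun j => T ∩ A j) (fun x => Finset.univ.biUnion x) ?_ ?_ ?_ ?_ ?_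
    · intro T hT
      rw [mem_powerset] at hT
      rw [Fintype.mem_piFinset]
      intro j
      rw [mem_powerset]
      exact inter_subset_inter_right hT
    · intro x hx
      rw [Fintype.mem_piFinset] at hx
      rw [mem_powerset, biUnion_subset]
      intro j _
      exact (mem_powerset.1 (hx j)).trans inter_subset_left
    · intro T hT
      rw [mem_powerset] at hT
      exact (eq_biUnion_inter (hT.trans hS)).symm
    · intro x hx
      rw [Fintype.mem_piFinset] at hx
      funext j
      exact biUnion_inter_block hdis x (fun k => (mem_powerset.1 (hx k)).trans inter_subset_right) j
    · intro T _; rfl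
  rw [step1]
  -- step 2: group by the card vector
  have hmaps : ∀ x ∈ Fintype.piFinset (fun j => (S ∩ A j).powerset),
      (fun j => (x j).card) ∈ Fintype.piFinset (fun j => range ((S ∩ A j).card + 1)) := by
    intro x hx
    rw [Fintype.mem_piFinset] at hx ⊢
    intro j
    rw [mem_range, Nat.lt_succ_iff]
    exact card_le_card (mem_powerset.1 (hx j))
  rw [← Finset.sum_fiberwise_of_maps_to hmaps]
  refine Finset.sum_congr rfl fun i _ => ?_
  have hfib : ((Fintype.piFinset fun j => (S ∩ A j).powerset).filter fun x => (fun j => (x j).card) = i)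
      = Fintype.piFinset (fun j => powersetCard (i j) (S ∩ A j)) := by
    ext x
    simp only [mem_filter, Fintype.mem_piFinset, mem_powerset, mem_powersetCard, funext_iff]
    exact ⟨fun ⟨h1, h2⟩ j => ⟨h1 j, h2 j⟩, fun h => ⟨fun j => (h j).1, fun j => (h j).2⟩⟩
  have hconst : ∀ x ∈ (Fintype.piFinset fun j => (S ∩ A j).powerset).filter (fun x => (fun j => (x j).card) = i),
      G (fun j => (x j).card) = G i := by
    intro x hx
    rw [(mem_filter.1 hx).2]
  rw [Finset.sum_congr rfl hconst, Finset.sum_const, hfib, Fintype.card_piFinset]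
  congr 1
  exact Finset.prod_congr rfl fun j _ => card_powersetCard _ _

/-! ### Möbius coefficients of an m-block-symmetric function -/

/-- The m-fold binomial transform of a profile. -/
def gamM {R : Type*} [CommRing R] (Φh : (Fin m → ℕ) → R) (i : Fin m → ℕ) : R :=
  ∑ i' ∈ Fintype.piFinset (fun j => range (i j + 1)),
    (∏ j, (i j).choose (i' j)) • ((-1 : R) ^ (∑ j, i j - ∑ j, i' j) * Φh i')

/-- CharDial sub-characteristic helper `moeb_mBlock` (lens-6 g8 LAND package; see the module docstring). -/
theorem moeb_mBlock {R : Type*} [CommRing R] {A : Fin m → Finset (Fin n)}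
    (hdis : ∀ j k, j ≠ k → Disjoint (A j) (A k)) (g : (Fin n → Bool) → R) (Φh : (Fin m → ℕ) → R)
    (hg : ∀ T ⊆ blockUnion A, g (vert T) = Φh (fun j => (T ∩ A j).card))
    {S : Finset (Fin n)} (hS : S ⊆ blockUnion A) :
    moeb g S = gamM Φh (fun j => (S ∩ A j).card) := by
  classical
  unfold moeb gamM
  have h1 : ∀ T ∈ S.powerset, (-1 : R) ^ (S.card - T.card) * g (vert T) =
      (fun i' => (-1 : R) ^ (∑ j, (S ∩ A j).card - ∑ j, i' j) * Φh i') (fun j => (T ∩ A j).card) := by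
    intro T hT
    have hT' : T ⊆ blockUnion A := (mem_powerset.1 hT).trans hS
    simp only
    rw [hg T hT', card_eq_mBlock hdis hS, card_eq_mBlock hdis hT']
  rw [Finset.sum_congr rfl h1,
    sum_powerset_mBlock hdis hS (fun i' => (-1 : R) ^ (∑ j, (S ∩ A j).card - ∑ j, i' j) * Φh i')]

end SubChar

/-! ### The binomial basis of `𝔽_p[X_0, …, X_{m−1}]` -/

namespace FrobPlane

open MvPolynomial Finset Polynomial

variable {p : ℕ} [hp : Fact p.Prime] {m : ℕ}

/-- `C(X_k, i) = (i!)⁻¹ · Π_{l<i} (X_k − l)` in `m` variables. -/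
noncomputable def binomPm (k : Fin m) (i : ℕ) : MvPolynomial (Fin m) (ZMod p) :=
  MvPolynomial.C ((i.factorial : ZMod p)⁻¹) * ∏ l ∈ range i, (MvPolynomial.X k - MvPolynomial.C (l : ZMod p))

/-- CharDial sub-characteristic helper `totalDegree_binomPm` (lens-6 g8 LAND package; see the module docstring). -/
theorem totalDegree_binomPm (k : Fin m) (i : ℕ) : (binomPm (p := p) k i).totalDegree ≤ i := by
  unfold binomPm
  refine (totalDegree_mul _ _).trans ?_
  rw [totalDegree_C, zero_add]
  refine (totalDegree_finsetProd _ _).trans ?_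
  have : ∀ l ∈ range i,
      (MvPolynomial.X k - MvPolynomial.C (l : ZMod p) : MvPolynomial (Fin m) (ZMod p)).totalDegree ≤ 1 := by
    intro l _
    refine (totalDegree_sub _ _).trans (max_le ?_ ?_)
    · simp [totalDegree_X]
    · rw [totalDegree_C]; exact Nat.zero_le _
  exact (Finset.sum_le_sum this).trans (by simp)

/-- CharDial sub-characteristic helper `eval_binomPm` (lens-6 g8 LAND package; see the module docstring). -/
theorem eval_binomPm (x : Fin m → ZMod p) (k : Fin m) {i : ℕ} (hi : i < p) :
    MvPolynomial.eval x (binomPm k i) = (((x k).val.choose i : ℕ) : ZMod p) := by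
  unfold binomPm
  rw [MvPolynomial.eval_mul, MvPolynomial.eval_C, MvPolynomial.eval_prod]
  have h1 : ∏ l ∈ range i, MvPolynomial.eval x (MvPolynomial.X k - MvPolynomial.C (l : ZMod p))
      = ∏ l ∈ range i, (x k - (l : ZMod p)) := by
    refine Finset.prod_congr rfl fun l _ => ?_
    rw [MvPolynomial.eval_sub, MvPolynomial.eval_X, MvPolynomial.eval_C]
  rw [h1]
  conv_lhs => rw [← ZMod.natCast_zmod_val (x k)]
  rw [prod_range_sub_eq_descPochhammer, descPochhammer_eval_eq_descFactorial,
    Nat.descFactorial_eq_factorial_mul_choose, Nat.cast_mul]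
  have hfact : ((i.factorial : ℕ) : ZMod p) ≠ 0 := by
    rw [Ne, ZMod.natCast_eq_zero_iff]
    exact fun h => absurd ((hp.out.dvd_factorial).1 h) (by omega)
  rw [← mul_assoc, inv_mul_cancel₀ hfact, one_mul]

end FrobPlane

end Summit.QuantumAdvantage.AdviceFreeQNC0
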